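import Mathlib.Data.Real.Basic
import Mathlib.Tactic.Linarith
import Mathlib.Tactic.Positivity
import Mathlib.Tactic.FieldSimp
import Mathlib.Tactic.Ring
import HarnessLib

/-!
# `NoHeavyLowerTail` (crux stmt-CriticalPhenomena-4575), P2 — THE `(2,2)` ATOM: REMAINDER BOUNDS AT THE CORNERS `(1,1)` AND `(1,0)`

Seat `prim-masterthm-p2`, gen 29 (memo `FROM-prim-masterthm-p2-g29-SQUARE-IDENTITY.md` §9; `--supports stmt-CriticalPhenomena-4575`). Mathlib-only; no `sorry`.
Companion of `…SahiT2SquareRules` (pattern certificates).  Data on the square `0, Z, C, T`: `F, G, H̄ (= Hb), Ȳ (= Yb)` monotone along the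
edges, `Ȳ_x ≥ F_xH̄_x`, `F_T > 0`; `a = G_T−G_0`, `d = G_Z−G_C`, `κ_xy = (F_x−F_y)(G_x−G_y)`; the gen-29 rule (`ρ_0 = 0`, `ρ_T = 1−F_0/F_T`,
A1/A2/B1/B2 for the middle pair) substituted into `D_T0(η) = ρ_TȲ_T − (F_T−F_0)η` (`DT0r`) and `D_ZC(η) = ρ_ZȲ_Z − ρ_CȲ_C − (F_Z−F_C)η` (`DZC_*`).
`R_11 = aD_T0(H̄_T) + dD_ZC(H̄_T) + κ_TZ(H̄_T−H̄_C) + κ_TC(H̄_T−H̄_Z) ≥ 0` (`t2R11_*`) and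
`R_10 = aD_T0(H̄_Z) + dD_ZC(H̄_Z) − κ_Z0(H̄_T−H̄_Z) + κ_TZ(H̄_Z−H̄_0) ≥ 0` (`t2R10_*`); corners `(0,1)`, `(0,0)` are in `…SahiT2SquareCorner00`.
(All chains verified exactly on 1 328 cells, `code/gen29/finalcheck22.py`.) [this work]
-/

noncomputable section

namespace Summit.CriticalPhenomena.PercolationContinuityZ3.Theorems

namespace SahiT2Square

section Remainders

variable {F0 FZ FC FT G0 GZ GC GT YbZ YbC YbT Hb0 HbZ HbC HbT : ℝ}

/-- `D_ZC` for the four rules (with `ρ` substituted). -/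
def DZC_A1 (FZ FC FT YbC η : ℝ) : ℝ := 0 - (FC - FZ) / FT * YbC - (FZ - FC) * η
/-- see `DZC_A1`. -/
def DZC_A2 (FZ FC YbZ η : ℝ) : ℝ := (1 - FC / FZ) * YbZ - 0 - (FZ - FC) * η
/-- see `DZC_A1`. -/
def DZC_B1 (FZ FC YbC η : ℝ) : ℝ := 0 - (FC - FZ) / FC * YbC - (FZ - FC) * η
/-- see `DZC_A1`. -/
def DZC_B2 (FZ FC FT YbZ η : ℝ) : ℝ := (FZ - FC) / FT * YbZ - 0 - (FZ - FC) * η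
/-- `D_T0(η) = (1 − F_0/F_T)Ȳ_T − (F_T−F_0)η` (all rules). -/
def DT0r (F0 FT YbT η : ℝ) : ℝ := (1 - F0 / FT) * YbT - (FT - F0) * η

/-- `D_T0(η) = (F_T−F_0)·[(Ȳ_T/F_T − H̄_T) + (H̄_T − η)]` (slack form). -/
theorem DT0r_eq (hFT : 0 < FT) (η : ℝ) : DT0r F0 FT YbT η = (FT - F0) * ((YbT / FT - HbT) + (HbT - η)) := by
  unfold DT0r; field_simp; ring

/-- Edge remainder under `σ = (0, 1−F_lo/F_hi)`: `σ_hi(G_hi−G_lo)Ȳ_hi − κ·H̄_0 ≥ κ(H̄_hi − H̄_0)`, `κ = (F_hi−F_lo)(G_hi−G_lo)`. -/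
theorem t2edgeR {Flo Fhi Glo Ghi Ybhi Hbhi Hb0 : ℝ} (hF : 0 < Fhi) (hlh : Flo ≤ Fhi) (hG : Glo ≤ Ghi) (s : Fhi * Hbhi ≤ Ybhi) :
    (Fhi - Flo) * (Ghi - Glo) * (Hbhi - Hb0) ≤ (1 - Flo / Fhi) * (Ghi - Glo) * Ybhi - (Fhi - Flo) * (Ghi - Glo) * Hb0 := by
  have e : (1 - Flo / Fhi) * (Ghi - Glo) * Ybhi - (Fhi - Flo) * (Ghi - Glo) * Hb0 - (Fhi - Flo) * (Ghi - Glo) * (Hbhi - Hb0)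
      = (Fhi - Flo) * (Ghi - Glo) * (Ybhi / Fhi - Hbhi) := by field_simp; ring
  have sl : 0 ≤ Ybhi / Fhi - Hbhi := by rw [sub_nonneg, le_div_iff₀ hF]; linarith
  nlinarith [mul_nonneg (mul_nonneg (sub_nonneg.2 hlh) (sub_nonneg.2 hG)) sl]

/-! ### corner `(1,1)` -/

/-- Remainder bound `t2R11_A1` (memo §9; the inequality chain is the identity `e` plus the listed nonnegative products). -/
theorem t2R11_A1 (hFT : 0 < FT) (h0Z : F0 ≤ FZ) (hZC : FZ ≤ FC) (hCT : FC ≤ FT)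
    (g0C : G0 ≤ GC) (gCZ : GC ≤ GZ) (gZT : GZ ≤ GT)
    (hbZT : HbZ ≤ HbT) (hbCT : HbC ≤ HbT) (yCT : YbC ≤ YbT) (sT : FT * HbT ≤ YbT) :
    0 ≤ (GT - G0) * DT0r F0 FT YbT HbT + (GZ - GC) * DZC_A1 FZ FC FT YbC HbT
      + (FT - FZ) * (GT - GZ) * (HbT - HbC) + (FT - FC) * (GT - GC) * (HbT - HbZ) := by
  have sl : 0 ≤ YbT / FT - HbT := by rw [sub_nonneg, le_div_iff₀ hFT]; linarith
  have e : (GT - G0) * DT0r F0 FT YbT HbT + (GZ - GC) * DZC_A1 FZ FC FT YbC HbT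
      = ((GT - G0) - (GZ - GC)) * (FT - F0) * (YbT / FT - HbT) + (GZ - GC) * ((FT - F0) - (FC - FZ)) * (YbT / FT - HbT)
        + (GZ - GC) * ((FC - FZ) / FT) * (YbT - YbC) := by
    unfold DT0r DZC_A1; field_simp; ring
  rw [e]
  have := mul_nonneg (mul_nonneg (show 0 ≤ (GT - G0) - (GZ - GC) by linarith) (show 0 ≤ FT - F0 by linarith)) sl
  have := mul_nonneg (mul_nonneg (sub_nonneg.2 gCZ) (show 0 ≤ (FT - F0) - (FC - FZ) by linarith)) sl
  have := mul_nonneg (mul_nonneg (sub_nonneg.2 gCZ) (div_nonneg (sub_nonneg.2 hZC) hFT.le)) (sub_nonneg.2 yCT)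
  have := mul_nonneg (mul_nonneg (show 0 ≤ FT - FZ by linarith) (sub_nonneg.2 gZT)) (sub_nonneg.2 hbCT)
  have := mul_nonneg (mul_nonneg (sub_nonneg.2 hCT) (show 0 ≤ GT - GC by linarith)) (sub_nonneg.2 hbZT)
  linarith

/-- Remainder bound `t2R11_A2` (memo §9; the inequality chain is the identity `e` plus the listed nonnegative products). -/
theorem t2R11_A2 (hFT : 0 < FT) (hFZ : 0 < FZ) (h0T : F0 ≤ FT) (hCZ : FC ≤ FZ) (hZT : FZ ≤ FT) (hCT : FC ≤ FT)
    (g0T : G0 ≤ GT) (gCZ : GC ≤ GZ) (gZT : GZ ≤ GT)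
    (hbZT : HbZ ≤ HbT) (hbCT : HbC ≤ HbT) (sZ : FZ * HbZ ≤ YbZ) (sT : FT * HbT ≤ YbT) :
    0 ≤ (GT - G0) * DT0r F0 FT YbT HbT + (GZ - GC) * DZC_A2 FZ FC YbZ HbT
      + (FT - FZ) * (GT - GZ) * (HbT - HbC) + (FT - FC) * (GT - GC) * (HbT - HbZ) := by
  have sl : 0 ≤ YbT / FT - HbT := by rw [sub_nonneg, le_div_iff₀ hFT]; linarith
  have slZ : 0 ≤ YbZ / FZ - HbZ := by rw [sub_nonneg, le_div_iff₀ hFZ]; linarith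
  have e : (GT - G0) * DT0r F0 FT YbT HbT + (GZ - GC) * DZC_A2 FZ FC YbZ HbT + (FT - FC) * (GT - GC) * (HbT - HbZ)
      = (GT - G0) * (FT - F0) * (YbT / FT - HbT) + (GZ - GC) * (FZ - FC) * (YbZ / FZ - HbZ)
        + ((FT - FC) * (GT - GZ) + (GZ - GC) * (FT - FZ)) * (HbT - HbZ) := by
    unfold DT0r DZC_A2; field_simp; ring
  have := mul_nonneg (mul_nonneg (sub_nonneg.2 g0T) (sub_nonneg.2 h0T)) sl
  have := mul_nonneg (mul_nonneg (sub_nonneg.2 gCZ) (sub_nonneg.2 hCZ)) slZ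
  have := mul_nonneg (show 0 ≤ (FT - FC) * (GT - GZ) + (GZ - GC) * (FT - FZ) by
    have := mul_nonneg (sub_nonneg.2 hCT) (sub_nonneg.2 gZT); have := mul_nonneg (sub_nonneg.2 gCZ) (sub_nonneg.2 hZT); linarith)
    (sub_nonneg.2 hbZT)
  have := mul_nonneg (mul_nonneg (sub_nonneg.2 hZT) (sub_nonneg.2 gZT)) (sub_nonneg.2 hbCT)
  linarith

/-- Remainder bound `t2R11_B1` (memo §9; the inequality chain is the identity `e` plus the listed nonnegative products). -/
theorem t2R11_B1 (hFT : 0 < FT) (hFC : 0 < FC) (h0T : F0 ≤ FT) (hZC : FZ ≤ FC) (hCT : FC ≤ FT) (hZT : FZ ≤ FT)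
    (g0T : G0 ≤ GT) (gZC : GZ ≤ GC) (gCT : GC ≤ GT)
    (hbZT : HbZ ≤ HbT) (hbCT : HbC ≤ HbT) (sC : FC * HbC ≤ YbC) (sT : FT * HbT ≤ YbT) :
    0 ≤ (GT - G0) * DT0r F0 FT YbT HbT + (GZ - GC) * DZC_B1 FZ FC YbC HbT
      + (FT - FZ) * (GT - GZ) * (HbT - HbC) + (FT - FC) * (GT - GC) * (HbT - HbZ) := by
  have sl : 0 ≤ YbT / FT - HbT := by rw [sub_nonneg, le_div_iff₀ hFT]; linarith
  have slC : 0 ≤ YbC / FC - HbC := by rw [sub_nonneg, le_div_iff₀ hFC]; linarith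
  have e : (GT - G0) * DT0r F0 FT YbT HbT + (GZ - GC) * DZC_B1 FZ FC YbC HbT + (FT - FZ) * (GT - GZ) * (HbT - HbC)
      = (GT - G0) * (FT - F0) * (YbT / FT - HbT) + (GC - GZ) * (FC - FZ) * (YbC / FC - HbC)
        + ((FT - FZ) * (GT - GC) + (GC - GZ) * (FT - FC)) * (HbT - HbC) := by
    unfold DT0r DZC_B1; field_simp; ring
  have := mul_nonneg (mul_nonneg (sub_nonneg.2 g0T) (sub_nonneg.2 h0T)) sl
  have := mul_nonneg (mul_nonneg (sub_nonneg.2 gZC) (sub_nonneg.2 hZC)) slC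
  have := mul_nonneg (show 0 ≤ (FT - FZ) * (GT - GC) + (GC - GZ) * (FT - FC) by
    have := mul_nonneg (sub_nonneg.2 hZT) (sub_nonneg.2 gCT); have := mul_nonneg (sub_nonneg.2 gZC) (sub_nonneg.2 hCT); linarith)
    (sub_nonneg.2 hbCT)
  have := mul_nonneg (mul_nonneg (sub_nonneg.2 hCT) (sub_nonneg.2 gCT)) (sub_nonneg.2 hbZT)
  linarith

/-- Remainder bound `t2R11_B2` (memo §9; the inequality chain is the identity `e` plus the listed nonnegative products). -/
theorem t2R11_B2 (hFT : 0 < FT) (h0C : F0 ≤ FC) (hCZ : FC ≤ FZ) (hZT : FZ ≤ FT)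
    (g0Z : G0 ≤ GZ) (gZC : GZ ≤ GC) (gCT : GC ≤ GT)
    (hbZT : HbZ ≤ HbT) (hbCT : HbC ≤ HbT) (yZT : YbZ ≤ YbT) (sT : FT * HbT ≤ YbT) :
    0 ≤ (GT - G0) * DT0r F0 FT YbT HbT + (GZ - GC) * DZC_B2 FZ FC FT YbZ HbT
      + (FT - FZ) * (GT - GZ) * (HbT - HbC) + (FT - FC) * (GT - GC) * (HbT - HbZ) := by
  have sl : 0 ≤ YbT / FT - HbT := by rw [sub_nonneg, le_div_iff₀ hFT]; linarith
  have e : (GT - G0) * DT0r F0 FT YbT HbT + (GZ - GC) * DZC_B2 FZ FC FT YbZ HbT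
      = ((GT - G0) - (GC - GZ)) * (FT - F0) * (YbT / FT - HbT) + (GC - GZ) * ((FT - F0) - (FZ - FC)) * (YbT / FT - HbT)
        + (GC - GZ) * ((FZ - FC) / FT) * (YbT - YbZ) := by
    unfold DT0r DZC_B2; field_simp; ring
  rw [e]
  have := mul_nonneg (mul_nonneg (show 0 ≤ (GT - G0) - (GC - GZ) by linarith) (show 0 ≤ FT - F0 by linarith)) sl
  have := mul_nonneg (mul_nonneg (sub_nonneg.2 gZC) (show 0 ≤ (FT - F0) - (FZ - FC) by linarith)) sl
  have := mul_nonneg (mul_nonneg (sub_nonneg.2 gZC) (div_nonneg (sub_nonneg.2 hCZ) hFT.le)) (sub_nonneg.2 yZT)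
  have := mul_nonneg (mul_nonneg (sub_nonneg.2 hZT) (show 0 ≤ GT - GZ by linarith)) (sub_nonneg.2 hbCT)
  have := mul_nonneg (mul_nonneg (show 0 ≤ FT - FC by linarith) (sub_nonneg.2 gCT)) (sub_nonneg.2 hbZT)
  linarith

/-! ### corner `(1,0)` -/

/-- Remainder bound `t2R10_A1` (memo §9; the inequality chain is the identity `e` plus the listed nonnegative products). -/
theorem t2R10_A1 (hFT : 0 < FT) (h0Z : F0 ≤ FZ) (hZC : FZ ≤ FC) (hCT : FC ≤ FT)
    (g0C : G0 ≤ GC) (gCZ : GC ≤ GZ) (gZT : GZ ≤ GT)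
    (hb0Z : Hb0 ≤ HbZ) (hbZT : HbZ ≤ HbT) (yCT : YbC ≤ YbT) (sT : FT * HbT ≤ YbT) :
    0 ≤ (GT - G0) * DT0r F0 FT YbT HbZ + (GZ - GC) * DZC_A1 FZ FC FT YbC HbZ
      - (FZ - F0) * (GZ - G0) * (HbT - HbZ) + (FT - FZ) * (GT - GZ) * (HbZ - Hb0) := by
  have sl : 0 ≤ YbT / FT - HbT := by rw [sub_nonneg, le_div_iff₀ hFT]; linarith
  have e : (GT - G0) * DT0r F0 FT YbT HbZ + (GZ - GC) * DZC_A1 FZ FC FT YbC HbZ - (FZ - F0) * (GZ - G0) * (HbT - HbZ)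
      = (((GT - G0) - (GZ - GC)) * (FT - F0) + (GZ - GC) * ((FT - F0) - (FC - FZ))) * (YbT / FT - HbT)
        + ((FZ - F0) * (GT - GZ) + (GT - G0) * (FT - FC) + ((GT - GZ) + (GC - G0)) * (FC - FZ)) * (HbT - HbZ)
        + (GZ - GC) * ((FC - FZ) / FT) * (YbT - YbC) := by
    unfold DT0r DZC_A1; field_simp; ring
  rw [e]
  have c1 : 0 ≤ ((GT - G0) - (GZ - GC)) * (FT - F0) + (GZ - GC) * ((FT - F0) - (FC - FZ)) := by
    have := mul_nonneg (show 0 ≤ (GT - G0) - (GZ - GC) by linarith) (show 0 ≤ FT - F0 by linarith)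
    have := mul_nonneg (sub_nonneg.2 gCZ) (show 0 ≤ (FT - F0) - (FC - FZ) by linarith); linarith
  have c2 : 0 ≤ (FZ - F0) * (GT - GZ) + (GT - G0) * (FT - FC) + ((GT - GZ) + (GC - G0)) * (FC - FZ) := by
    have := mul_nonneg (sub_nonneg.2 h0Z) (sub_nonneg.2 gZT); have := mul_nonneg (show 0 ≤ GT - G0 by linarith) (sub_nonneg.2 hCT)
    have := mul_nonneg (show 0 ≤ (GT - GZ) + (GC - G0) by linarith) (sub_nonneg.2 hZC); linarith
  have := mul_nonneg c1 sl; have := mul_nonneg c2 (sub_nonneg.2 hbZT)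
  have := mul_nonneg (mul_nonneg (sub_nonneg.2 gCZ) (div_nonneg (sub_nonneg.2 hZC) hFT.le)) (sub_nonneg.2 yCT)
  have := mul_nonneg (mul_nonneg (show 0 ≤ FT - FZ by linarith) (sub_nonneg.2 gZT)) (sub_nonneg.2 hb0Z)
  linarith

/-- Remainder bound `t2R10_A2` (memo §9; the inequality chain is the identity `e` plus the listed nonnegative products). -/
theorem t2R10_A2 (hFT : 0 < FT) (hFZ : 0 < FZ) (h0Z : F0 ≤ FZ) (hCZ : FC ≤ FZ) (hZT : FZ ≤ FT)
    (g0Z : G0 ≤ GZ) (gCZ : GC ≤ GZ) (gZT : GZ ≤ GT)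
    (hb0Z : Hb0 ≤ HbZ) (hbZT : HbZ ≤ HbT) (sZ : FZ * HbZ ≤ YbZ) (sT : FT * HbT ≤ YbT) :
    0 ≤ (GT - G0) * DT0r F0 FT YbT HbZ + (GZ - GC) * DZC_A2 FZ FC YbZ HbZ
      - (FZ - F0) * (GZ - G0) * (HbT - HbZ) + (FT - FZ) * (GT - GZ) * (HbZ - Hb0) := by
  have sl : 0 ≤ YbT / FT - HbT := by rw [sub_nonneg, le_div_iff₀ hFT]; linarith
  have slZ : 0 ≤ YbZ / FZ - HbZ := by rw [sub_nonneg, le_div_iff₀ hFZ]; linarith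
  have e : (GT - G0) * DT0r F0 FT YbT HbZ + (GZ - GC) * DZC_A2 FZ FC YbZ HbZ - (FZ - F0) * (GZ - G0) * (HbT - HbZ)
      = (GT - G0) * (FT - F0) * (YbT / FT - HbT) + ((FZ - F0) * (GT - GZ) + (GT - G0) * (FT - FZ)) * (HbT - HbZ)
        + (GZ - GC) * (FZ - FC) * (YbZ / FZ - HbZ) := by
    unfold DT0r DZC_A2; field_simp; ring
  rw [e]
  have := mul_nonneg (mul_nonneg (show 0 ≤ GT - G0 by linarith) (show 0 ≤ FT - F0 by linarith)) sl
  have c2 : 0 ≤ (FZ - F0) * (GT - GZ) + (GT - G0) * (FT - FZ) := by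
    have := mul_nonneg (sub_nonneg.2 h0Z) (sub_nonneg.2 gZT); have := mul_nonneg (show 0 ≤ GT - G0 by linarith) (sub_nonneg.2 hZT); linarith
  have := mul_nonneg c2 (sub_nonneg.2 hbZT); have := mul_nonneg (mul_nonneg (sub_nonneg.2 gCZ) (sub_nonneg.2 hCZ)) slZ
  have := mul_nonneg (mul_nonneg (sub_nonneg.2 hZT) (sub_nonneg.2 gZT)) (sub_nonneg.2 hb0Z)
  linarith

/-- Remainder bound `t2R10_B1` (memo §9; the inequality chain is the identity `e` plus the listed nonnegative products). -/
theorem t2R10_B1 (hFT : 0 < FT) (hFC : 0 < FC) (h0Z : F0 ≤ FZ) (hZC : FZ ≤ FC) (hCT : FC ≤ FT)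
    (g0Z : G0 ≤ GZ) (gZC : GZ ≤ GC) (gCT : GC ≤ GT)
    (hb0Z : Hb0 ≤ HbZ) (hb0C : Hb0 ≤ HbC) (hbZT : HbZ ≤ HbT) (sC : FC * HbC ≤ YbC) (sT : FT * HbT ≤ YbT) :
    0 ≤ (GT - G0) * DT0r F0 FT YbT HbZ + (GZ - GC) * DZC_B1 FZ FC YbC HbZ
      - (FZ - F0) * (GZ - G0) * (HbT - HbZ) + (FT - FZ) * (GT - GZ) * (HbZ - Hb0) := by
  have sl : 0 ≤ YbT / FT - HbT := by rw [sub_nonneg, le_div_iff₀ hFT]; linarith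
  have slC : 0 ≤ YbC / FC - HbC := by rw [sub_nonneg, le_div_iff₀ hFC]; linarith
  have e : (GT - G0) * DT0r F0 FT YbT HbZ + (GZ - GC) * DZC_B1 FZ FC YbC HbZ - (FZ - F0) * (GZ - G0) * (HbT - HbZ)
      + (FT - FZ) * (GT - GZ) * (HbZ - Hb0)
      = (GT - G0) * (FT - F0) * (YbT / FT - HbT) + ((FZ - F0) * (GT - GZ) + (GT - G0) * (FT - FZ)) * (HbT - HbZ)
        + ((FT - FZ) * (GT - GC) + (GC - GZ) * (FT - FC)) * (HbZ - Hb0) + (GC - GZ) * (FC - FZ) * (HbC - Hb0)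
        + (GC - GZ) * (FC - FZ) * (YbC / FC - HbC) := by
    unfold DT0r DZC_B1; field_simp; ring
  rw [e]
  have := mul_nonneg (mul_nonneg (show 0 ≤ GT - G0 by linarith) (show 0 ≤ FT - F0 by linarith)) sl
  have c2 : 0 ≤ (FZ - F0) * (GT - GZ) + (GT - G0) * (FT - FZ) := by
    have := mul_nonneg (sub_nonneg.2 h0Z) (show 0 ≤ GT - GZ by linarith)
    have := mul_nonneg (show 0 ≤ GT - G0 by linarith) (show 0 ≤ FT - FZ by linarith); linarith
  have c3 : 0 ≤ (FT - FZ) * (GT - GC) + (GC - GZ) * (FT - FC) := by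
    have := mul_nonneg (show 0 ≤ FT - FZ by linarith) (sub_nonneg.2 gCT); have := mul_nonneg (sub_nonneg.2 gZC) (sub_nonneg.2 hCT); linarith
  have := mul_nonneg c2 (sub_nonneg.2 hbZT); have := mul_nonneg c3 (sub_nonneg.2 hb0Z)
  have := mul_nonneg (mul_nonneg (sub_nonneg.2 gZC) (sub_nonneg.2 hZC)) (sub_nonneg.2 hb0C)
  have := mul_nonneg (mul_nonneg (sub_nonneg.2 gZC) (sub_nonneg.2 hZC)) slC
  linarith

/-- Remainder bound `t2R10_B2` (memo §9; the inequality chain is the identity `e` plus the listed nonnegative products). -/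
theorem t2R10_B2 (hFT : 0 < FT) (h0C : F0 ≤ FC) (hCZ : FC ≤ FZ) (hZT : FZ ≤ FT)
    (g0Z : G0 ≤ GZ) (gZC : GZ ≤ GC) (gCT : GC ≤ GT)
    (hb0Z : Hb0 ≤ HbZ) (hbZT : HbZ ≤ HbT) (yZT : YbZ ≤ YbT) (sT : FT * HbT ≤ YbT) :
    0 ≤ (GT - G0) * DT0r F0 FT YbT HbZ + (GZ - GC) * DZC_B2 FZ FC FT YbZ HbZ
      - (FZ - F0) * (GZ - G0) * (HbT - HbZ) + (FT - FZ) * (GT - GZ) * (HbZ - Hb0) := by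
  have sl : 0 ≤ YbT / FT - HbT := by rw [sub_nonneg, le_div_iff₀ hFT]; linarith
  have e : (GT - G0) * DT0r F0 FT YbT HbZ + (GZ - GC) * DZC_B2 FZ FC FT YbZ HbZ - (FZ - F0) * (GZ - G0) * (HbT - HbZ)
      = (((GT - G0) - (GC - GZ)) * (FT - F0) + (GC - GZ) * ((FT - F0) - (FZ - FC))) * (YbT / FT - HbT)
        + ((FZ - F0) * (GT - GC) + (GC - GZ) * (FC - F0) + (GT - G0) * (FT - FZ)) * (HbT - HbZ)
        + (GC - GZ) * ((FZ - FC) / FT) * (YbT - YbZ) := by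
    unfold DT0r DZC_B2; field_simp; ring
  rw [e]
  have c1 : 0 ≤ ((GT - G0) - (GC - GZ)) * (FT - F0) + (GC - GZ) * ((FT - F0) - (FZ - FC)) := by
    have := mul_nonneg (show 0 ≤ (GT - G0) - (GC - GZ) by linarith) (show 0 ≤ FT - F0 by linarith)
    have := mul_nonneg (sub_nonneg.2 gZC) (show 0 ≤ (FT - F0) - (FZ - FC) by linarith); linarith
  have c2 : 0 ≤ (FZ - F0) * (GT - GC) + (GC - GZ) * (FC - F0) + (GT - G0) * (FT - FZ) := by
    have := mul_nonneg (show 0 ≤ FZ - F0 by linarith) (show 0 ≤ GT - GC by linarith)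
    have := mul_nonneg (sub_nonneg.2 gZC) (sub_nonneg.2 h0C); have := mul_nonneg (show 0 ≤ GT - G0 by linarith) (sub_nonneg.2 hZT)
    linarith
  have := mul_nonneg c1 sl; have := mul_nonneg c2 (sub_nonneg.2 hbZT)
  have := mul_nonneg (mul_nonneg (sub_nonneg.2 gZC) (div_nonneg (sub_nonneg.2 hCZ) hFT.le)) (sub_nonneg.2 yZT)
  have := mul_nonneg (mul_nonneg (sub_nonneg.2 hZT) (show 0 ≤ GT - GZ by linarith)) (sub_nonneg.2 hb0Z)
  linarith

end Remainders

end SahiT2Square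

end Summit.CriticalPhenomena.PercolationContinuityZ3.Theorems
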